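import Literature.NumberTheory.LFunctions.Zhang2022.RepairInPrintLengths
import Literature.NumberTheory.LFunctions.AsymptoticLargeSieve
import Literature.NumberTheory.LFunctions.TwistedSecondMomentModuliAverage
import Literature.NumberTheory.LFunctions.TwistedSecondMomentPrimeModulus

/-!
# Zhang (2022) §18-margin repair rung — barrier extension «LENGTHS `≥ P` WITH ONLY IN-PRINT
# OFF-DIAGONAL INPUT», addendum: the PRINT CEILING of the asymptotic-large-sieve / twisted-moment
# technology is again EXACTLY the wall `P` (T-2 ADDENDUM, kind THRESHOLD; the attached family is NON-COVERING)

Trunk T-ANT (NumberTheory/LFunctions). Y. Zhang, *Discrete mean estimates and the Landau–Siegel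
zero*, arXiv:2211.02515v1 (2022) [Zhang2022LandauSiegel] — **an unrefereed manuscript under
adjudication. WHAT THIS IS NOT: nothing here asserts or denies its Theorems 1–2 or any analytic lemma;
no claim about Landau–Siegel zeros, about Parity, or about a repaired `Margin232` is made. Every
statement below is about the manuscript's METHOD AS ARCHITECTED — the class of parametrised designs
`θ` fed to the SAME main-term calculus — not about zeros of `L`-functions.** Cell `landau-siegel`
(rung F-S3), sub-cell E (barrier extension), seat p4, row S-E-p4-9 of `barrier/ASSIGNMENTS.md`
(ls-barrier-plan g1, 2026-08-27T00:16:43Z: «T-2 ADD: ALS as fifth disjunct, exponent-model currency, wall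
unchanged — labelled THRESHOLD/T-2 ADD, never coverage»). It is the kernel twin of the §B-len print-ceiling
memo `B-len/CEILING-len.md` v1.1 §§1–2 (ls-Blen-plan): «every PRINTED asymptotic evaluation of a
twisted/mollified second moment in a GL(1) family with the diagonal as the only main term stops at
`θ_print < 1` — it REACHES the wall from below and never crosses it».

## What `RepairInPrintLengths` (p459189, T-2) already says

With the off-diagonal of formula I modelled as dyadic modulus blocks `R = P^ρ`, `ρ ∈ [0, ν₁]`
(`Repair.modulusExponents`), the four inputs the manuscript's §7 actually uses or that bound Kloosterman
fractions in print — small moduli (Lemma 5.6), the multiplicative large sieve ((7.15)), DFI 1997, BC 2018 —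
control every block iff `ν₁ < 1` (`Repair.inPrintOffDiagonalRange_iff_belowP`): the printed range is the wall.
The manuscript itself places its mollifier length there and names the technology: «if `h(s,ψ)` is of the
above form [a `μψ`-mollifier of length `P′`] with `P′` slightly smaller than `P` in the logarithmic scale, the
sum in (2.16) can be evaluated. This is analogous to the results of Conrey, Iwaniec and Soundararajan [5]
and [6]» (§2, «A heuristic argument», between (2.16) and (2.17), p. 5; [5] = the Asymptotic Large Sieve).

## What this addendum adds: the printed ASYMPTOTIC inputs, read in the manuscript's length coordinate

The three asymptotic-large-sieve-type evaluations held in the tree as named facts, each with its length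
hypotheses QUOTED from the typed statement, and the dictionary (RECONSTRUCTED desk bookkeeping, labelled as
such, same convention as T-2: `P`-exponents only; the conductor of `ψ (mod p)`, `p ≍ P`, is `P^{1+o(1)}`; a
Dirichlet-polynomial piece supported on `n ≤ P^ν` has length exponent `ν`; the `H₁₁`-mollifier `ϰ₁` has
`ν = ν₁`, (2.21)/(2.23); in `Θ₁(a₁,a₂)` of Prop. 7.1 the `ψ`-sum pairs `Σ_m (κ∗a₁)(m)ψ(m)m^{−s}` — effective
length `m = dl`, `l ∈ 𝔌(Rh) = [⅓Pt₀Rh, 4Pt₀Rh]`, `dhr < P₁`, i.e. `P^{1+ν₁+o(1)}` (tex L1953–L2033) — against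
`A(a₂; 1−s, ψ̄)` of length `< P₁`):

* GLOBAL READING (the family `ψ mod p` itself plays the printed family of conductor `Q ↔ P`; box `N ↔ P^{1+ν₁}`;
  mollifier-factor length `X ↔ P^{ν₁}`):
  - `ALS24Range ν` — Conrey–Iwaniec–Soundararajan, *Asymptotic Large Sieve*, Theorem 2.4
    (`Literature.NumberTheory.LFunctions.AsymptoticLargeSieve.conreyIwaniecSoundararajanALS_theorem24`, p452329):
    hypotheses `N ≤ Q^(2−δ)`, `X ≤ Q^(1−ε)`, `X ≤ Q^(1−2δ)` with `0 < δ`, `0 < ε` ↦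
    `∃ ε δ > 0, 1 + ν ≤ 2 − δ ∧ ν ≤ 1 − ε ∧ ν ≤ 1 − 2δ`;
  - `ALS22Range ν` — ibid. Theorem 2.2 (`…ALS_theorem22`, general coefficients): `N ≤ Q^(1−ε)` ↦
    `∃ ε > 0, 1 + ν ≤ 1 − ε`;
  - `CIS19Range ν` — Conrey–Iwaniec–Soundararajan 2019, Theorem 1
    (`Literature.NumberTheory.LFunctions.conreyIwaniecSoundararajan2019_theorem1`, p453166): twists of length
    `Q^ϑ`, `0 < ϑ < 1`, error `Q^{savingExponent ϑ + ε}` which is a power saving iff `ϑ < 1`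
    (`CIS2019.savingExponent_lt_two_iff`) ↦ `∃ ϑ > 0, CIS2019.savingExponent ϑ < 2 ∧ ν ≤ ϑ`;
  - `BPRZ11Range ν` / `BPRZ12Range ν` — Bui–Pratt–Robles–Zaharescu 2020, Theorems 1.1/1.2
    (`…buiPrattRoblesZaharescu2020_theorem11/_theorem12`, one prime modulus `q ↔ p ≍ P`): twist length `q^κ`
    with `κ < 1/2 + 1/202`, resp. factorable `κ = κ₁ + κ₂`, `9κ + max κ₁ κ₂ < 5` ↦ `ν ≤ κ` under those
    constraints.
  THREE MISMATCHES ARE GRANTED in the design's favour and displayed here, not typed: (m1) the printed families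
  are ALL moduli `q ≍ Q` with a smooth weight (`AsymptoticLargeSieve.IsFamilyWeight Ψ`; CIS19's `W`) or ONE prime
  modulus, never the window of primes `p ∼ P` (registry E-076 enabler / lever L13: no prime-moduli asymptotic
  large sieve is in print or in the tree); (m2) Theorem 2.4's coefficients are `ζ`-mollifier shaped
  (`zetaMollifierCoeff ρ`, `IsMollifierFactor`), whereas `κ` is the Dirichlet series of
  `ζ(s+β₁)ζ(s+β₂)ζ(s+β₃)/ζ(s)` (tex L1940); (m3) the weights `Z(s,ψ)⁻¹`, `(pt₀)^{β₃}`, `ω(s)`, `Δ` of (7.1)–(7.8)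
  versus the test-function classes `IsLocalizedTestFunction` / (8.8′). Granting them only enlarges the slot.
* BLOCK READING (the asymptotic large sieve used INSTEAD of the multiplicative large sieve inside (7.15), on
  the block of moduli `R = P^ρ` after the switch to characters `θ (mod r)` of (7.12): family `Q ↔ R = P^ρ`, box
  `N ↔ P^{1+ρ}` (the `l`-variable; the `p`-variable has length `P ≤ P^{1+ρ}`), factor length `X ↔ P^{ν₁}` (the
  `a₁` inside `(κ∗a₁)(dl)`)): `ALSBlockControls ν₁ ρ := ∃ ε δ > 0, (1 + ρ ≤ ρ(1−ε)) ∨ (1 + ρ ≤ ρ(2−δ) ∧ ν₁ ≤ ρ(1−ε))`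
  — Theorem 2.2's range, or Theorem 2.4's two ranges. Since every block has `ρ ≤ ν₁` (`dhr < P₁`, tex L2028),
  the factor-length hypothesis `X ≤ Q^{1−ε}` reads `ν₁ ≤ ρ(1−ε) < ν₁`: **no block of any design satisfies it**
  (`not_alsBlockControls`), and Theorem 2.2's `N ≤ Q^{1−ε}` reads `1 + ρ ≤ ρ(1 − ε)`, false for `ρ ≥ 0`.

## Theorems

* `printedAsymptoticRange_iff_lt_one (0 < ν) : PrintedAsymptoticRange ν ↔ ν < 1` — the union of the five
  global ranges is EXACTLY `ν < 1` (`→`: each range separately, `als24Range_lt_one`, `not_als22Range`,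
  `cis19Range_lt_one`, `bprz11Range_lt`, `bprz12Range_lt`; `←`: Theorem 2.4's range with `ε = δ = (1−ν)/2`).
  THE PRINT CEILING REACHES THE WALL AND DOES NOT CROSS IT.
* `not_alsBlockControls (0 < ν₁) (ρ ≤ ν₁)` — the block reading never applies.
* **`inPrintOffDiagonalRangeCeiling_iff_belowP (0 < ν₁) : InPrintOffDiagonalRangeCeiling θ ↔ θ.belowP`** — the
  T-2 slot enlarged by the block-reading disjunct on every block AND by the global printed-asymptotic range is
  still exactly the wall; `inPrintOffDiagonalRangeCeiling_of_inPrint` (C2: the T-2 slot implies this one).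
* **`not_repairable_inPrint_ceiling : ∀ θ, AdmissibleThetaLen θ → InPrintOffDiagonalRangeCeiling θ →
  ¬ (C232S θ * C233T θ < ‖dSumS θ‖ ^ 2)`** via `Repair.not_repairable_true_need` (p428635);
  `familyInPrintCeiling` + `_decided`, `rplus_inPrintCeiling_decided`; C4 witnesses: `theta0` (slot holds),
  `thetaLen ν`, `ν ≥ 1` (in the class, slot FAILS: `not_inPrintOffDiagonalRangeCeiling_thetaLen` — load-bearing).

CURRENCY (C3(e) of barrier/REF-E.md): T-true on `R` with the tree's functionals `C232S`/`C233T`/`dSumS`, exactly as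
T-2; nothing is evaluated at `ν₁ ≥ 1`. KIND: THRESHOLD / T-2 ADDENDUM — the attached family is NON-COVERING (its
verdict is vacuous beyond the wall, where the slot is refuted, and is `familyR`'s verdict on `R`); it counts for
NO §B word. What a length `≥ P` needs is unchanged and is NOT supplied by any printed ASYMPTOTIC either: an
off-diagonal MAIN TERM for the prime family at `ν₁ > 1` (registry E-001/E-002; `Repair.lengthsBeyondP_independent`,
p463543, shows the printed inputs decide it neither way), and for arbitrary / `μ`-type coefficients an
asymptotic-to-diagonal long moment is priced RH-strength by the tree's limitation theorems
`Literature.Barriers.RiemannHypothesis.Radziwill2012_thm1` / `BettinGonek2017_thm1` (registry E-078; CEILING-len §3).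
The named facts above are cited BY NAME for their hypotheses; none is consumed by a proof (they are
[claim]/[cite]-status statements about other families); the only tree lemma consumed is
`CIS2019.savingExponent_lt_two_iff`. Numerical certificates: none (printed rationals compared by `norm_num`).

SCOPE CAVEAT — THE QUADRATIC-FAMILY TWIN (words only; ls-barrier-plan g1 2026-08-27T00:37:09Z on lit/r4/ROWS.md
DELTA v1.2 «the symplectic wall in one unit», READING (6)–(8); no decl, no disjunct: the slot's input list is about
the manuscript's `χψ` / prime-moduli family). In the family `𝓓 = {χ_{8d} : d ≤ X odd square-free}` write `𝓛` for
the length of a statistic as a LINEAR form in `χ_{8d}`; Heath-Brown's quadratic large sieve has diagonal =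
off-diagonal at `𝓛 = X²`, which is the same place as the mollifier edge `θ = 1` of the mollified second moment
`Σ_d |L(½,χ_{8d})M(χ_{8d})|²`, `M` of length `X^{θ/2}`. In print AT that wall only STRUCTURED (divisor-type)
coefficients are evaluated — the fourth moment `Σ_d L(½,χ_{8d})⁴`, unconditionally, at relative precision
`(log X)^{−4+ε}` (Shen–Stucky, arXiv:2402.01497, Thm 1.1 / Prop 1.3) — while every statistic with a `μ`-type
(mollifier) factor stops at `𝓛 < X^{2−ε}` (Soundararajan, Ann. of Math. 152 (2000), arXiv:math/9902163, the
`7/8` theorem: `M ≤ X^{1/2−ε}`); NOTHING is in print at mollifier length exactly `X^{1/2}`. So there, as here, the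
printed range reaches the wall from below with structured coefficients sitting exactly on it, and the question beyond
is a COEFFICIENT-CLASS question (an off-diagonal main term for `μ`-type coefficients), not a range to be read off a
printed theorem.

References: Y. Zhang, arXiv:2211.02515v1 (2022), §2 «A heuristic argument» p. 5 (the `P′ < P` sentence citing
[5], [6]); §7 Prop. 7.1, (7.2), (7.12)–(7.15), tex L1814, L1940–L2058 [pp. 36–39] [cite: Zhang2022LandauSiegel, §§2, 7] ·
Conrey–Iwaniec–Soundararajan, *Asymptotic large sieve*, arXiv:1105.1176, Theorems 2.2, 2.4, §8 (8.7)–(8.8′)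
[cite: ConreyIwaniecSoundararajan2011ALS, Theorems 2.2, 2.4] · Conrey–Iwaniec–Soundararajan, Funct. Approx. 61 (2019),
Theorem 1 [cite: ConreyIwaniecSoundararajan2019MeanSquare, Theorem 1] · Bui–Pratt–Robles–Zaharescu, Adv. Math. 370
(2020), Theorems 1.1–1.2 [cite: BuiPrattRoblesZaharescu2020, Theorems 1.1–1.2].
«The programme SEARCHES and TYPES; no claim about Landau–Siegel zeros, Theorems 1–2 of arXiv:2211.02515 or a
repaired Margin232 until a kernel theorem says so.»
-/

noncomputable section

open Real Complex ComplexConjugate Set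

namespace Literature.NumberTheory.LFunctions.Zhang2022

namespace Repair

variable {θ : Theta} {ν ρ : ℝ}

/-! ### The printed asymptotic inputs as length ranges (GLOBAL reading: `Q ↔ P`, `N ↔ P^{1+ν}`, `X ↔ P^ν`) -/

/-- Range of CIS *Asymptotic Large Sieve* Theorem 2.4 (`…ALS_theorem24`: `N ≤ Q^(2−δ)`, `X ≤ Q^(1−ε)`,
`X ≤ Q^(1−2δ)`, `0 < δ`, `0 < ε`) for a mollifier piece of length `P^ν` paired at conductor `P`
(box `P^{1+ν}`, factor length `P^ν`): some admissible `ε, δ` put the design inside the printed range.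
[cite: ConreyIwaniecSoundararajan2011ALS, Theorem 2.4 and §8 (8.7)–(8.8)] -/
def ALS24Range (ν : ℝ) : Prop :=
  ∃ ε δ : ℝ, 0 < ε ∧ 0 < δ ∧ 1 + ν ≤ 2 - δ ∧ ν ≤ 1 - ε ∧ ν ≤ 1 - 2 * δ

/-- Range of CIS *Asymptotic Large Sieve* Theorem 2.2 (`…ALS_theorem22`, general coefficients: `N ≤ Q^(1−ε)`,
`0 < ε`) in the same reading (box `P^{1+ν}` at conductor `P`). [cite: ConreyIwaniecSoundararajan2011ALS, Theorem 2.2] -/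
def ALS22Range (ν : ℝ) : Prop :=
  ∃ ε : ℝ, 0 < ε ∧ 1 + ν ≤ 1 - ε

/-- Range of CIS 2019 Theorem 1 (`conreyIwaniecSoundararajan2019_theorem1`: twists of length `Q^ϑ`, `0 < ϑ`,
error exponent `CIS2019.savingExponent ϑ = 2 − (1−ϑ)/2`, a power saving against the `Q²` main terms iff it is
`< 2`) for a piece of length `P^ν`: `ν ≤ ϑ` for some `ϑ` at which the printed error term saves a power.
[cite: ConreyIwaniecSoundararajan2019MeanSquare, Theorem 1] -/
def CIS19Range (ν : ℝ) : Prop :=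
  ∃ ϑ : ℝ, 0 < ϑ ∧ CIS2019.savingExponent ϑ < 2 ∧ ν ≤ ϑ

/-- Range of Bui–Pratt–Robles–Zaharescu 2020 Theorem 1.1 (`buiPrattRoblesZaharescu2020_theorem11`, one prime
modulus `q ↔ p ≍ P`, arbitrary coefficients: twist length `q^κ`, `0 < κ < 1/2 + 1/202`).
[cite: BuiPrattRoblesZaharescu2020, Theorem 1.1] -/
def BPRZ11Range (ν : ℝ) : Prop :=
  ∃ κ : ℝ, 0 < κ ∧ κ < 1 / 2 + 1 / 202 ∧ ν ≤ κ

/-- Range of Bui–Pratt–Robles–Zaharescu 2020 Theorem 1.2 (`buiPrattRoblesZaharescu2020_theorem12`, factorable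
coefficients `η ∗ λ` of lengths `q^{κ₁}`, `q^{κ₂}`, `κ = κ₁ + κ₂`, `9κ + max κ₁ κ₂ < 5`).
[cite: BuiPrattRoblesZaharescu2020, Theorem 1.2] -/
def BPRZ12Range (ν : ℝ) : Prop :=
  ∃ κ₁ κ₂ : ℝ, 0 < κ₁ ∧ 0 < κ₂ ∧ 9 * (κ₁ + κ₂) + max κ₁ κ₂ < 5 ∧ ν ≤ κ₁ + κ₂

/-- **The printed asymptotic range** (GLOBAL reading): the length `P^ν` lies inside the range of at least one
of the five printed asymptotic evaluations above — every mismatch of family / coefficient shape / weights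
(m1)–(m3) of the module docstring being granted in the design's favour.
[cite: ConreyIwaniecSoundararajan2011ALS, Theorems 2.2, 2.4] -/
def PrintedAsymptoticRange (ν : ℝ) : Prop :=
  ALS24Range ν ∨ ALS22Range ν ∨ CIS19Range ν ∨ BPRZ11Range ν ∨ BPRZ12Range ν

/-! ### Each printed range stops before the wall `ν = 1` -/

/-- Theorem 2.4's range forces `ν < 1` (already `X ≤ Q^(1−ε)` alone: `ν ≤ 1 − ε`).
[cite: ConreyIwaniecSoundararajan2011ALS, Theorem 2.4] -/
theorem als24Range_lt_one (h : ALS24Range ν) : ν < 1 := by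
  obtain ⟨ε, δ, hε, -, -, hX, -⟩ := h
  linarith

/-- Theorem 2.2's range is EMPTY for pieces of non-negative length exponent (`1 + ν ≤ 1 − ε` forces `ν < 0`):
with general coefficients the asymptotic large sieve does not even reach the diagonal range.
[cite: ConreyIwaniecSoundararajan2011ALS, Theorem 2.2] -/
theorem not_als22Range (h0 : 0 ≤ ν) : ¬ ALS22Range ν := by
  rintro ⟨ε, hε, h⟩
  linarith

/-- CIS 2019's range forces `ν < 1` (the saving `2 − (1−ϑ)/2 < 2` is `ϑ < 1`, `CIS2019.savingExponent_lt_two_iff`).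
[cite: ConreyIwaniecSoundararajan2019MeanSquare, Theorem 1] -/
theorem cis19Range_lt_one (h : CIS19Range ν) : ν < 1 := by
  obtain ⟨ϑ, -, hs, hν⟩ := h
  have hϑ : ϑ < 1 := (CIS2019.savingExponent_lt_two_iff ϑ).1 hs
  linarith

/-- BPRZ Theorem 1.1's range forces `ν < 51/101` (one modulus: just beyond the square root, far inside the wall).
[cite: BuiPrattRoblesZaharescu2020, Theorem 1.1] -/
theorem bprz11Range_lt (h : BPRZ11Range ν) : ν < 51 / 101 := by
  obtain ⟨κ, -, hκ, hν⟩ := h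
  norm_num at hκ
  linarith

/-- BPRZ Theorem 1.2's range forces `ν < 5/9` (`9κ < 9κ + max κ₁ κ₂ < 5`).
[cite: BuiPrattRoblesZaharescu2020, Theorem 1.2] -/
theorem bprz12Range_lt (h : BPRZ12Range ν) : ν < 5 / 9 := by
  obtain ⟨κ₁, κ₂, h1, h2, hκ, hν⟩ := h
  have hm : 0 ≤ max κ₁ κ₂ := le_max_of_le_left h1.le
  linarith

/-- **Every printed asymptotic range stops strictly before the wall**: `PrintedAsymptoticRange ν → ν < 1`
(for `ν ≥ 0`). [cite: ConreyIwaniecSoundararajan2011ALS, Theorems 2.2, 2.4] -/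
theorem lt_one_of_printedAsymptoticRange (h0 : 0 ≤ ν) (h : PrintedAsymptoticRange ν) : ν < 1 := by
  rcases h with h | h | h | h | h
  · exact als24Range_lt_one h
  · exact absurd h (not_als22Range h0)
  · exact cis19Range_lt_one h
  · linarith [bprz11Range_lt h]
  · linarith [bprz12Range_lt h]

/-- … and it REACHES the wall from below: every `0 < ν < 1` is inside Theorem 2.4's range
(`ε = δ = (1 − ν)/2`). [cite: ConreyIwaniecSoundararajan2011ALS, Theorem 2.4] -/
theorem als24Range_of_lt_one (h1 : ν < 1) : ALS24Range ν :=
  ⟨(1 - ν) / 2, (1 - ν) / 2, by linarith, by linarith, by linarith, by linarith, by linarith⟩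

/-- **THE PRINT CEILING IS EXACTLY THE WALL**: for `ν ≥ 0`, `PrintedAsymptoticRange ν ↔ ν < 1`.
[cite: ConreyIwaniecSoundararajan2011ALS, Theorems 2.2, 2.4] -/
theorem printedAsymptoticRange_iff_lt_one (h0 : 0 ≤ ν) : PrintedAsymptoticRange ν ↔ ν < 1 :=
  ⟨lt_one_of_printedAsymptoticRange h0, fun h1 => Or.inl (als24Range_of_lt_one h1)⟩

/-! ### The BLOCK reading: the asymptotic large sieve in place of the large sieve inside (7.15) -/

/-- «The asymptotic large sieve controls the block `R = P^ρ`» of a design whose `H₁₁`-mollifier has length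
exponent `ν` (BLOCK reading: family `θ (mod r)`, `r ≍ R`, so `Q ↔ P^ρ`; box `N ↔ P^{1+ρ}` = the `l`-variable
`𝔌(Rh)`; factor length `X ↔ P^ν` = the `a₁` inside `(κ∗a₁)(dl)`): Theorem 2.2's range `N ≤ Q^(1−ε)`, or
Theorem 2.4's ranges `N ≤ Q^(2−δ)` and `X ≤ Q^(1−ε)`, for some admissible `ε, δ`.
[cite: Zhang2022LandauSiegel, §7 (7.12)–(7.15), p.38–39] -/
def ALSBlockControls (ν ρ : ℝ) : Prop :=
  ∃ ε δ : ℝ, 0 < ε ∧ 0 < δ ∧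
    (1 + ρ ≤ ρ * (1 - ε) ∨ (1 + ρ ≤ ρ * (2 - δ) ∧ ν ≤ ρ * (1 - ε)))

/-- **No block of any design is controlled by the asymptotic large sieve**: the blocks have `ρ ≤ ν₁`
(`dhr < P₁`, tex L2028), so Theorem 2.4's factor-length hypothesis reads `ν₁ ≤ ρ(1−ε) < ν₁`, and Theorem 2.2's
box hypothesis reads `1 + ρ ≤ ρ(1−ε) ≤ ρ`. [cite: Zhang2022LandauSiegel, §7 (7.13), (7.15), tex L2028, p.38] -/
theorem not_alsBlockControls (hν : 0 < ν) (h0 : 0 ≤ ρ) (hρ : ρ ≤ ν) : ¬ ALSBlockControls ν ρ := by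
  rintro ⟨ε, δ, hε, -, h | ⟨-, hX⟩⟩
  · nlinarith [mul_nonneg h0 hε.le]
  · -- `ν ≤ ρ(1−ε) = ρ − ρε ≤ ν − ρε` forces `ρε ≤ 0`, hence `ρ = 0`, hence `ν ≤ 0`.
    have h1 : ρ * ε ≤ 0 := by nlinarith
    have h2 : ρ * ε = 0 := le_antisymm h1 (mul_nonneg h0 hε.le)
    have hρ0 : ρ = 0 := by
      rcases mul_eq_zero.1 h2 with h | h
      · exact h
      · exact absurd h hε.ne'
    subst hρ0
    linarith

/-! ### The enlarged slot and the wall -/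

/-- **The displayed slot «only in-print off-diagonal input, printed ASYMPTOTICS included» (kind (c))**: EITHER
every formula-I block of the design is controlled by one of the four T-2 inputs or by the asymptotic large
sieve in the block reading, OR the design's mollifier length lies in the printed asymptotic range in the
global reading. A bare `Prop` over exponents; no `ν₁ < 1` conjunct; not `Eq148DUniform` (E-016).
[cite: Zhang2022LandauSiegel, §7 (7.2), (7.11)–(7.15), p.36–39] -/
def InPrintOffDiagonalRangeCeiling (θ : Theta) : Prop :=
  (∀ ρ ∈ modulusExponents θ,
      (SmallModuliControlled ρ ∨ LargeSieveControls ρ ∨ DFIControls ρ ∨ BCControls ρ) ∨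
        ALSBlockControls θ.nu1 ρ) ∨
    PrintedAsymptoticRange θ.nu1

/-- C2: the T-2 slot implies the enlarged slot (the enlargement narrows nothing).
[cite: Zhang2022LandauSiegel, §7 (7.15), p.38–39] -/
theorem inPrintOffDiagonalRangeCeiling_of_inPrint (h : InPrintOffDiagonalRange θ) :
    InPrintOffDiagonalRangeCeiling θ :=
  Or.inl fun ρ hρ => Or.inl (h ρ hρ)

/-- **The enlarged slot still forces `ν₁ < 1`**: on the top block `ρ = ν₁` the four T-2 inputs fail at
`ν₁ ≥ 1` (`not_inPrintControlled_of_one_le`) and the block reading of the asymptotic large sieve fails always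
(`not_alsBlockControls`); the global printed-asymptotic range is `ν₁ < 1` (`lt_one_of_printedAsymptoticRange`).
[cite: Zhang2022LandauSiegel, §7 (7.2), (7.15), p.36–39] -/
theorem belowP_of_inPrintOffDiagonalRangeCeiling (h0 : 0 < θ.nu1) (h : InPrintOffDiagonalRangeCeiling θ) :
    θ.belowP := by
  unfold Theta.belowP
  rcases h with h | h
  · by_contra hge
    have h1 : 1 ≤ θ.nu1 := not_lt.1 hge
    rcases h θ.nu1 ⟨h0.le, le_rfl⟩ with hc | hc
    · exact not_inPrintControlled_of_one_le h1 hc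
    · exact not_alsBlockControls h0 h0.le le_rfl hc
  · exact lt_one_of_printedAsymptoticRange h0.le h

/-- Conversely every design with `ν₁ < 1` carries the enlarged slot (through the T-2 slot).
[cite: Zhang2022LandauSiegel, §7 (7.2), (7.15), p.36–39] -/
theorem inPrintOffDiagonalRangeCeiling_of_belowP (hP : θ.belowP) : InPrintOffDiagonalRangeCeiling θ :=
  inPrintOffDiagonalRangeCeiling_of_inPrint (inPrintOffDiagonalRange_of_belowP hP)

/-- **THE PRINTED RANGE — BOUNDS AND ASYMPTOTICS TOGETHER — IS EXACTLY THE WALL**: for `ν₁ > 0`,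
`InPrintOffDiagonalRangeCeiling θ ↔ ν₁ < 1`. [cite: Zhang2022LandauSiegel, §7 (7.2), (7.15), p.36–39] -/
theorem inPrintOffDiagonalRangeCeiling_iff_belowP (h0 : 0 < θ.nu1) :
    InPrintOffDiagonalRangeCeiling θ ↔ θ.belowP :=
  ⟨belowP_of_inPrintOffDiagonalRangeCeiling h0, inPrintOffDiagonalRangeCeiling_of_belowP⟩

/-- The enlarged slot and the T-2 slot are equivalent (both are the wall), for `ν₁ > 0`.
[cite: Zhang2022LandauSiegel, §7 (7.2), (7.15), p.36–39] -/
theorem inPrintOffDiagonalRangeCeiling_iff_inPrint (h0 : 0 < θ.nu1) :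
    InPrintOffDiagonalRangeCeiling θ ↔ InPrintOffDiagonalRange θ :=
  (inPrintOffDiagonalRangeCeiling_iff_belowP h0).trans (inPrintOffDiagonalRange_iff_belowP h0.le).symm

/-- A design of `R_len` whose only off-diagonal input is printed (asymptotics included) is a design of `R`.
[cite: Zhang2022LandauSiegel, §2 (2.21)–(2.26); §7 (7.2), (7.15)] -/
theorem admissible_of_len_inPrintCeiling (h : AdmissibleThetaLen θ) (hs : InPrintOffDiagonalRangeCeiling θ) :
    AdmissibleTheta θ :=
  h.toAdmissible (belowP_of_inPrintOffDiagonalRangeCeiling (by linarith [h.half_lt_nu1]) hs)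

/-! ### The verdict theorems -/

/-- **NOT-REPAIRABLE with lengths `≥ P` admitted and only in-print off-diagonal input — printed ASYMPTOTICS
(asymptotic large sieve, CIS 2019, BPRZ 2020) included.** For every design of `R_len` carrying the enlarged slot
`InPrintOffDiagonalRangeCeiling θ`, the joint main-order criterion of the §2 endgame fails:
`¬ (C₂₃₂(θ)·C₂₃₃(θ) < |𝔡+𝔡′|²(θ))` — the slot forces `ν₁ < 1` and on `R` this is
`Repair.not_repairable_true_need` (p428635). [cite: Zhang2022LandauSiegel, §2 Props. 2.4–2.6, (2.32)–(2.33); §7 (7.2), (7.15)] -/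
theorem not_repairable_inPrint_ceiling :
    ∀ θ, AdmissibleThetaLen θ → InPrintOffDiagonalRangeCeiling θ → ¬ (C232S θ * C233T θ < ‖dSumS θ‖ ^ 2) :=
  fun _ h hs => not_repairable_true_need _ (admissible_of_len_inPrintCeiling h hs)

/-- Cauchy–Schwarz companion under the enlarged slot. [cite: Zhang2022LandauSiegel, §2 after (2.33)] -/
theorem normSq_dSumS_le_inPrintCeiling (h : AdmissibleThetaLen θ) (hs : InPrintOffDiagonalRangeCeiling θ) :
    ‖dSumS θ‖ ^ 2 ≤ C232S θ * C233T θ :=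
  normSq_dSumS_le θ (admissible_of_len_inPrintCeiling h hs)

/-- Printed-chain companion under the enlarged slot: the printed triple `C₂₃₂ < 0.001 ∧ C₂₃₃ < 3000 ∧
|𝔡+𝔡′|² > 25` is not met. [cite: Zhang2022LandauSiegel, §2 Props. 2.4–2.5, (2.32)–(2.33)] -/
theorem not_printed_chain_inPrintCeiling (h : AdmissibleThetaLen θ) (hs : InPrintOffDiagonalRangeCeiling θ) :
    ¬ (C232S θ < 1 / 1000 ∧ C233T θ < 3000 ∧ 25 < ‖dSumS θ‖ ^ 2) :=
  not_printed_chain_in_class θ (admissible_of_len_inPrintCeiling h hs)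

/-! ### Non-vacuity of the class and load-bearing slot (C4) -/

/-- The printed point `θ₀` carries the enlarged slot (its `ν₁ = 0.504` is inside Theorem 2.4's range, and its
blocks are inside the large-sieve range). [cite: Zhang2022LandauSiegel, §2 (2.21); §7 (7.15)] -/
theorem inPrintOffDiagonalRangeCeiling_theta0 : InPrintOffDiagonalRangeCeiling theta0 :=
  inPrintOffDiagonalRangeCeiling_of_inPrint inPrintOffDiagonalRange_theta0

/-- **The enlarged slot is load-bearing**: at and beyond the wall (`ν ≥ 1`) it FAILS on the long members
`thetaLen ν ∈ R_len` — no printed asymptotic rescues a length `≥ P`, and such designs are not decided here.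
[cite: Zhang2022LandauSiegel, §7 (7.2), (7.15)] -/
theorem not_inPrintOffDiagonalRangeCeiling_thetaLen (h : 1 ≤ ν) : ¬ InPrintOffDiagonalRangeCeiling (thetaLen ν) := by
  intro hs
  have hP := belowP_of_inPrintOffDiagonalRangeCeiling (θ := thetaLen ν) (by change (0:ℝ) < ν; linarith) hs
  change ν < 1 at hP
  linarith

/-- In particular no printed asymptotic range contains a length `≥ P`.
[cite: ConreyIwaniecSoundararajan2011ALS, Theorems 2.2, 2.4] -/
theorem not_printedAsymptoticRange_of_one_le (h : 1 ≤ ν) : ¬ PrintedAsymptoticRange ν :=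
  fun hs => absurd (lt_one_of_printedAsymptoticRange (by linarith) hs) (not_lt.2 h)

/-- … whereas `thetaLen ν` with `0.502 < ν < 1` carries the slot and the verdict (a class-`R` design).
[cite: Zhang2022LandauSiegel, §2 (2.21)–(2.26); §7 (7.2)] -/
theorem not_repairable_thetaLen_ceiling_of_lt_one (h : 0.502 < ν) (h1 : ν < 1) :
    InPrintOffDiagonalRangeCeiling (thetaLen ν) ∧
      ¬ (C232S (thetaLen ν) * C233T (thetaLen ν) < ‖dSumS (thetaLen ν)‖ ^ 2) :=
  have hs : InPrintOffDiagonalRangeCeiling (thetaLen ν) :=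
    inPrintOffDiagonalRangeCeiling_of_belowP (by change ν < 1; exact h1)
  ⟨hs, not_repairable_inPrint_ceiling _ (admissibleThetaLen_thetaLen h) hs⟩

/-! ### Extension protocol: the family and `R⁺ ++ [R_len(ceiling)]` -/

/-- family «`R_len`, T-true currency, enlarged in-print slot (printed asymptotics included) displayed in the
verdict». NON-COVERING (vacuous beyond the wall). [cite: Zhang2022LandauSiegel, §2 (2.32)–(2.33); §7 (7.2), (7.15)] -/
def familyInPrintCeiling : DesignFamily where
  Design := Theta
  InClass := AdmissibleThetaLen
  Verdict θ := InPrintOffDiagonalRangeCeiling θ → ¬ (C232S θ * C233T θ < ‖dSumS θ‖ ^ 2)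

/-- `R_len` with the enlarged slot is decided. [cite: Zhang2022LandauSiegel, §2 (2.32)–(2.33); §7 (7.2), (7.15)] -/
theorem familyInPrintCeiling_decided : familyInPrintCeiling.Decided := not_repairable_inPrint_ceiling

/-- The verdict beyond the wall is FREE (the referee's T-2 probe, re-proved for the enlarged slot): no class
hypothesis needed. [cite: Zhang2022LandauSiegel, §7 (7.2), (7.15)] -/
theorem familyInPrintCeiling_verdict_vacuous_beyond_wall (θ : Theta) (h1 : 1 ≤ θ.nu1) :
    familyInPrintCeiling.Verdict θ :=
  fun hs => absurd (belowP_of_inPrintOffDiagonalRangeCeiling (by linarith) hs) (not_lt.2 h1)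

/-- C2 at family level: every `familyInPrintLen` (T-2) design is a `familyInPrintCeiling` design with the same
class, and the two verdicts agree (the slots are equivalent on the class).
[cite: Zhang2022LandauSiegel, §2 (2.32)–(2.33); §7 (7.15)] -/
theorem familyInPrintLen_verdict_iff (θ : Theta) (h : familyInPrintLen.InClass θ) :
    familyInPrintCeiling.InClass θ ∧ (familyInPrintCeiling.Verdict θ ↔ familyInPrintLen.Verdict θ) := by
  have h0 : 0 < θ.nu1 := by linarith [AdmissibleThetaLen.half_lt_nu1 h]
  refine ⟨h, ⟨fun hv hs => hv ((inPrintOffDiagonalRangeCeiling_iff_inPrint h0).2 hs),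
    fun hv hs => hv ((inPrintOffDiagonalRangeCeiling_iff_inPrint h0).1 hs)⟩⟩

/-- C2 from `R`: every `familyR` design is in the class, carries the enlarged slot, and the verdicts agree.
[cite: Zhang2022LandauSiegel, §2 (2.32)–(2.33)] -/
theorem familyR_inClass_toCeiling (θ : Theta) (h : familyR.InClass θ) :
    familyInPrintCeiling.InClass θ ∧ InPrintOffDiagonalRangeCeiling θ ∧
      (familyInPrintCeiling.Verdict θ ↔ familyR.Verdict θ) :=
  have hs := inPrintOffDiagonalRangeCeiling_of_inPrint (inPrintOffDiagonalRange_of_admissible h)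
  ⟨AdmissibleTheta.toLen h, hs, ⟨fun hv => hv hs, fun hv _ => hv⟩⟩

/-- **`R⁺ ++ [R_len(ceiling)]` is decided** (for the running assembly; appending is harmless and NON-COVERING).
[cite: Zhang2022LandauSiegel, §2 (2.32)–(2.33); §7 (7.2), (7.15)] -/
theorem rplus_inPrintCeiling_decided : ClassDecided (Rplus ++ [familyInPrintCeiling]) :=
  rplus_extend familyInPrintCeiling_decided

end Repair

end Literature.NumberTheory.LFunctions.Zhang2022
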